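import Summits.CriticalPhenomena.PercolationContinuityZ3.Theses.PercExchangeRateTransport

/-!
# Crux `PercExchangeRateTransport.SupercritExchangeUniformity` (stmt-CriticalPhenomena-16061, K⁺):
# the regime split `OffWindowLimit → LimitFieldRegular → WindowFlatness → RussoPositivity → K⁺`,
# and its converse `K⁺ → RussoPositivity → (OffWindowLimit ∧ LimitFieldRegular ∧ WindowFlatness)`

Strategist split file (crux-strategist seat `cstrat-stmt-CriticalPhenomena-16061-b1`, 2026-08-17),
sorry-free, landed `--supports stmt-CriticalPhenomena-16061` with the four pieces registered as stubs of
the item (`OffWindowLimit`, `LimitFieldRegular`, `WindowFlatness`, `RussoPositivity`) and spelled out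
VERBATIM as hypotheses below (no vendored `Prop` definitions).  It puts into the tree the COMPOSITION of
the regime decomposition of K⁺ — the route's foreseen glued split `K⁺ ⇐ WindowRatioLimit +
SupercritOffWindow` (route header, TWO-LAYER PLAN) in the fixed-`ε`-interface typing of the registered
birth skeleton `Cruxes/SupercritExchangeUniformity/Lines/birth.lean` (stubs `stub_offWindowLimit`,
`stub_limitFieldRegular`, `stub_windowFlatness`) — with ONE change of cut: the elementary Russo
positivity `∂_pΘ_n > 0` is separated from the window statement, so that the open core
(`WindowFlatness`) carries no bookkeeping and the bookkeeping (`RussoPositivity`) can land on its own;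
and it PROVES the converse, so that the split is certified lossless modulo `RussoPositivity`.

Objects (the route's `let`s): the label-coupled anisotropic bond family on `ℤ² × ℤ` (`x`,`y`-bonds
open iff `U_e ≤ p`, `z`-bonds iff `U_e ≤ t`); `Θ_n(p,t) = P(0 ↔ ∂Λ_n)`, `θ(p,t) = P(|C(0)| = ∞)`,
`p_c(t) = inf ({p ∈ [0,1] | θ(p,t) > 0} ∪ {1})`, `a_n = ∂_tΘ_n / ∂_pΘ_n` (the finite-volume EXCHANGE
RATE), `a_∞ = lim_n a_n` its pointwise `limUnder`.

* `OffWindowLimit` — ∀ [lo,hi] ⊂ (0,1) ∃ ρ>0 ∀ ε>0 ∀ η>0 ∃ m ∀ n ≥ m, t ∈ [lo,hi],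
  p ∈ [p_c(t)+ε, p_c(t)+ρ]: `|∂_tΘ_n − a_∞ ∂_pΘ_n| ≤ η ∂_pΘ_n` — locally uniform convergence of the
  exchange rate OFF every ε-window, to its pointwise limit (supercritical-phase analysis: ξ < ∞,
  `Θ_n → θ` with derivatives; Grimmett–Marstrand / Chayes–Chayes–Newman / Georgakopoulos–Panagiotis
  technology, two-parameter Russo);
* `LimitFieldRegular` — ∀ [lo,hi] ∃ ρ>0, L, a: `a` continuous on the CLOSED ρ-collar, L-Lipschitz in
  `p` there, `a = a_∞` strictly above the curve (boundary regularity of the limit field, "no fan",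
  infinite-volume version);
* `WindowFlatness` — ∀ [lo,hi] ∀ η>0 ∃ ε>0 ∃ m ∀ n ≥ m, t ∈ [lo,hi], p,p′ ∈ [p_c(t), p_c(t)+ε]:
  `|a_n(p,t) − a_n(p′,t)| ≤ η` — asymptotic flatness of the finite-volume exchange rate across the
  window from above ("no fan", finite-size version: THE OPEN CORE — a ratio-limit statement for two
  pivotal intensities uniform through the critical window in `d = 3`);
* `RussoPositivity` — ∀ [lo,hi] ∃ ε>0 ∀ n ≥ 1, t ∈ [lo,hi], p ∈ [p_c(t), p_c(t)+ε]: `0 < ∂_pΘ_n(p,t)`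
  (Russo's formula for the polynomial `Θ_n`: the straight `x`-path is pivotal with positive
  probability; needs `0 < p_c(t)` and `p_c(t) + ε < 1`, i.e. `p_c(t) ≤ p_c(ℤ²) = 1/2`).

Theorems (all sorry-free; axioms `propext`, `Classical.choice`, `Quot.sound`):
* `seam` — percolation-free three-ε real algebra over abstract `N D pc a`;
* `SupercritExchangeUniformity_of_subs : OffWindowLimit → LimitFieldRegular → WindowFlatness →
  RussoPositivity → SupercritExchangeUniformity` (conclusion = the route decl BY NAME): `ρ := min ρ₁ ρ₂`,
  restrict continuity / Lipschitz, `a = a_∞` off the curve turns piece 1 into convergence to `a` off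
  every ε-window, and the seam extends it through the window;
* `subs_of_SupercritExchangeUniformity : SupercritExchangeUniformity → RussoPositivity →
  OffWindowLimit ∧ LimitFieldRegular ∧ WindowFlatness` (the split is LOSSLESS modulo positivity: K⁺
  forces `a_n → a` pointwise on the positivity window, hence `a = a_∞` there (`ρ := min ρ ε₀`), and
  flatness by `η/3 + η/3 + L·ε`).

Census of the four strategist lenses on this crux: `Cruxes/SupercritExchangeUniformity/STRATEGY-CENSUS.md`.
-/

noncomputable section

namespace Summit.CriticalPhenomena.PercolationContinuityZ3.SupercritExchangeUniformitySplit

open MeasureTheory Filter Topology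
open Literature.Probability.Percolation Literature.Probability.LatticeModels
open Summit.CriticalPhenomena.PercolationContinuityZ3.Theses.PercExchangeRateTransport (SupercritExchangeUniformity)

/-! ## Named objects (the route's `let`s) and `Iff.rfl` readings -/

/-- The vertical (`z`-) bonds of `ℤ³ = ℤ² × ℤ`. -/
def vertBonds : Set (Sym2 (Site 3)) := {e | ∃ x : Site 3, e = s(x, x + Pi.single (2 : Fin 3) 1)}

/-- The label-coupled anisotropic configuration at levels `(p, t)`. -/
def cfgA (p t : ℝ) (U : Sym2 (Site 3) → ℝ) : Set (Sym2 (Site 3)) :=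
  {e | e ∈ (zdGraph 3).edgeSet ∧ ((e ∈ vertBonds ∧ U e ≤ t) ∨ (e ∉ vertBonds ∧ U e ≤ p))}

/-- `Θ_n(p,t) = P(0 ↔ ∂Λ_n)`. -/
def boxArm (n : ℕ) (p t : ℝ) : ℝ :=
  (labelMeasure (Site 3)).real {U | cfgA p t U ∈ siteToBoundary 3 n}

/-- `θ(p,t) = P(|C(0)| = ∞)`. -/
def thetaA (p t : ℝ) : ℝ :=
  (labelMeasure (Site 3)).real {U | cfgA p t U ∈ percolatesAt (0 : Site 3)}

/-- `p_c(t)`. -/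
def pcA (t : ℝ) : ℝ := sInf ({p : ℝ | 0 ≤ p ∧ p ≤ 1 ∧ 0 < thetaA p t} ∪ {1})

/-- `∂_t Θ_n(p,t)`. -/
def dT (n : ℕ) (p t : ℝ) : ℝ := deriv (fun s => boxArm n p s) t

/-- `∂_p Θ_n(p,t)`. -/
def dP (n : ℕ) (p t : ℝ) : ℝ := deriv (fun q => boxArm n q t) p

/-- `a_∞(p,t) := lim_n ∂_tΘ_n/∂_pΘ_n` (`limUnder`). -/
def rateLim (p t : ℝ) : ℝ := limUnder atTop (fun n : ℕ => dT n p t / dP n p t)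


/-! ## `Iff.rfl` readings of the crux and of the four verbatim pieces over the named objects -/

/-- The crux, unfolded over the named objects. -/
theorem crux_iff : SupercritExchangeUniformity ↔
    ∀ lo hi : ℝ, 0 < lo → lo < hi → hi < 1 → ∃ ρ > (0 : ℝ), ∃ L : ℝ, ∃ a : ℝ → ℝ → ℝ,
      ContinuousOn (fun x : ℝ × ℝ => a x.1 x.2)
          {x : ℝ × ℝ | x.2 ∈ Set.Icc lo hi ∧ pcA x.2 ≤ x.1 ∧ x.1 ≤ pcA x.2 + ρ} ∧
        (∀ t ∈ Set.Icc lo hi, ∀ p q : ℝ, pcA t ≤ p → p ≤ pcA t + ρ → pcA t ≤ q → q ≤ pcA t + ρ →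
          |a p t - a q t| ≤ L * |p - q|) ∧
        ∀ η > (0 : ℝ), ∃ m : ℕ, ∀ n ≥ m, ∀ t ∈ Set.Icc lo hi, ∀ p : ℝ, pcA t ≤ p → p ≤ pcA t + ρ →
          |dT n p t - a p t * dP n p t| ≤ η * dP n p t :=
  Iff.rfl

/-- Piece 1 (`OffWindowLimit`, verbatim) over the named objects. -/
theorem offWindowLimit_iff :
    (let μ := Literature.Probability.Percolation.labelMeasure (Literature.Probability.LatticeModels.Site 3); let vert : Sym2 (Literature.Probability.LatticeModels.Site 3) → Prop := fun e => ∃ x : Literature.Probability.LatticeModels.Site 3, e = s(x, x + Pi.single (2 : Fin 3) 1); let cfg : ℝ → ℝ → (Sym2 (Literature.Probability.LatticeModels.Site 3) → ℝ) → Set (Sym2 (Literature.Probability.LatticeModels.Site 3)) := fun p t U => {e | e ∈ (Literature.Probability.LatticeModels.zdGraph 3).edgeSet ∧ ((vert e ∧ U e ≤ t) ∨ (¬ vert e ∧ U e ≤ p))}; let Θ : ℕ → ℝ → ℝ → ℝ := fun n p t => μ.real {U | cfg p t U ∈ Literature.Probability.Percolation.siteToBoundary 3 n}; let θ : ℝ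 → ℝ → ℝ := fun p t => μ.real {U | cfg p t U ∈ Literature.Probability.Percolation.percolatesAt (0 : Literature.Probability.LatticeModels.Site 3)}; let pc : ℝ → ℝ := fun t => sInf ({p : ℝ | 0 ≤ p ∧ p ≤ 1 ∧ 0 < θ p t} ∪ {1}); let aInf : ℝ → ℝ → ℝ := fun p t => limUnder Filter.atTop (fun n : ℕ => deriv (fun s => Θ n p s) t / deriv (fun q => Θ n q t) p); ∀ lo hi : ℝ, 0 < lo → lo < hi → hi < 1 → ∃ ρ > (0 : ℝ), ∀ ε > (0 : ℝ), ∀ η > (0 : ℝ), ∃ m : ℕ, ∀ n ≥ m, ∀ t ∈ Set.Icc lo hi, ∀ p : ℝ, pc t + ε ≤ p → p ≤ pc t + ρ → |deriv (fun s => Θ n p s) t - aInf p t * deriv (fun q => Θ n q t) p| ≤ η * deriv (fun q => Θ n q t) p) ↔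
    ∀ lo hi : ℝ, 0 < lo → lo < hi → hi < 1 → ∃ ρ > (0 : ℝ), ∀ ε > (0 : ℝ), ∀ η > (0 : ℝ), ∃ m : ℕ,
      ∀ n ≥ m, ∀ t ∈ Set.Icc lo hi, ∀ p : ℝ, pcA t + ε ≤ p → p ≤ pcA t + ρ →
        |dT n p t - rateLim p t * dP n p t| ≤ η * dP n p t :=
  Iff.rfl

/-- Piece 2 (`LimitFieldRegular`, verbatim) over the named objects. -/
theorem limitFieldRegular_iff :
    (let μ := Literature.Probability.Percolation.labelMeasure (Literature.Probability.LatticeModels.Site 3); let vert : Sym2 (Literature.Probability.LatticeModels.Site 3) → Prop := fun e => ∃ x : Literature.Probability.LatticeModels.Site 3, e = s(x, x + Pi.single (2 : Fin 3) 1); let cfg : ℝ → ℝ → (Sym2 (Literature.Probability.LatticeModels.Site 3) → ℝ) → Set (Sym2 (Literature.Probability.LatticeModels.Site 3)) := fun p t U => {e | e ∈ (Literature.Probability.LatticeModels.zdGraph 3).edgeSet ∧ ((vert e ∧ U e ≤ t) ∨ (¬ vert e ∧ U e ≤ p))}; let Θ : ℕ → ℝ → ℝ → ℝ := fun n p t =>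 μ.real {U | cfg p t U ∈ Literature.Probability.Percolation.siteToBoundary 3 n}; let θ : ℝ → ℝ → ℝ := fun p t => μ.real {U | cfg p t U ∈ Literature.Probability.Percolation.percolatesAt (0 : Literature.Probability.LatticeModels.Site 3)}; let pc : ℝ → ℝ := fun t => sInf ({p : ℝ | 0 ≤ p ∧ p ≤ 1 ∧ 0 < θ p t} ∪ {1}); let aInf : ℝ → ℝ → ℝ := fun p t => limUnder Filter.atTop (fun n : ℕ => deriv (fun s => Θ n p s) t / deriv (fun q => Θ n q t) p); ∀ lo hi : ℝ, 0 < lo → lo < hi → hi < 1 → ∃ ρ > (0 : ℝ), ∃ L : ℝ, ∃ a : ℝ → ℝ → ℝ, ContinuousOn (fun x : ℝ × ℝ => a x.1 x.2) {x : ℝ × ℝ | x.2 ∈ Set.Icc lo hi ∧ pc x.2 ≤ x.1 ∧ x.1 ≤ pc x.2 + ρ} ∧ (∀ t ∈ Set.Icc lo hi, ∀ p q : ℝ, pc t ≤ p → p ≤ pc t + ρ → pc t ≤ q → q ≤ pc t + ρ → |a p t - a q t| ≤ L * |p - q|) ∧ ∀ t ∈ Set.Icc lo hi, ∀ p : ℝ,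 pc t < p → p ≤ pc t + ρ → a p t = aInf p t) ↔
    ∀ lo hi : ℝ, 0 < lo → lo < hi → hi < 1 → ∃ ρ > (0 : ℝ), ∃ L : ℝ, ∃ a : ℝ → ℝ → ℝ,
      ContinuousOn (fun x : ℝ × ℝ => a x.1 x.2)
          {x : ℝ × ℝ | x.2 ∈ Set.Icc lo hi ∧ pcA x.2 ≤ x.1 ∧ x.1 ≤ pcA x.2 + ρ} ∧
        (∀ t ∈ Set.Icc lo hi, ∀ p q : ℝ, pcA t ≤ p → p ≤ pcA t + ρ → pcA t ≤ q → q ≤ pcA t + ρ →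
          |a p t - a q t| ≤ L * |p - q|) ∧
        ∀ t ∈ Set.Icc lo hi, ∀ p : ℝ, pcA t < p → p ≤ pcA t + ρ → a p t = rateLim p t :=
  Iff.rfl

/-- Piece 3 (`WindowFlatness`, verbatim) over the named objects. -/
theorem windowFlatness_iff :
    (let μ := Literature.Probability.Percolation.labelMeasure (Literature.Probability.LatticeModels.Site 3); let vert : Sym2 (Literature.Probability.LatticeModels.Site 3) → Prop := fun e => ∃ x : Literature.Probability.LatticeModels.Site 3, e = s(x, x + Pi.single (2 : Fin 3) 1); let cfg : ℝ → ℝ → (Sym2 (Literature.Probability.LatticeModels.Site 3) → ℝ) → Set (Sym2 (Literature.Probability.LatticeModels.Site 3)) := fun p t U => {e | e ∈ (Literature.Probability.LatticeModels.zdGraph 3).edgeSet ∧ ((vert e ∧ U e ≤ t) ∨ (¬ vert e ∧ U e ≤ p))}; let Θ : ℕ → ℝ → ℝ → ℝ := fun n p t => μ.real {U | cfg p t U ∈ Literature.Probability.Percolation.siteToBoundary 3 n}; let θ : ℝ → ℝ → ℝ := fun p t => μ.real {U | cfg p t U ∈ Literature.Probability.Percolation.percolatesAt (0 : Literature.Probability.LatticeModels.Site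 3)}; let pc : ℝ → ℝ := fun t => sInf ({p : ℝ | 0 ≤ p ∧ p ≤ 1 ∧ 0 < θ p t} ∪ {1}); ∀ lo hi : ℝ, 0 < lo → lo < hi → hi < 1 → ∀ η > (0 : ℝ), ∃ ε > (0 : ℝ), ∃ m : ℕ, ∀ n ≥ m, ∀ t ∈ Set.Icc lo hi, ∀ p p' : ℝ, pc t ≤ p → p ≤ pc t + ε → pc t ≤ p' → p' ≤ pc t + ε → |deriv (fun s => Θ n p s) t / deriv (fun q => Θ n q t) p - deriv (fun s => Θ n p' s) t / deriv (fun q => Θ n q t) p'| ≤ η) ↔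
    ∀ lo hi : ℝ, 0 < lo → lo < hi → hi < 1 → ∀ η > (0 : ℝ), ∃ ε > (0 : ℝ), ∃ m : ℕ, ∀ n ≥ m,
      ∀ t ∈ Set.Icc lo hi, ∀ p p' : ℝ, pcA t ≤ p → p ≤ pcA t + ε → pcA t ≤ p' → p' ≤ pcA t + ε →
        |dT n p t / dP n p t - dT n p' t / dP n p' t| ≤ η :=
  Iff.rfl

/-- Piece 4 (`RussoPositivity`, verbatim) over the named objects. -/
theorem russoPositivity_iff :
    (let μ := Literature.Probability.Percolation.labelMeasure (Literature.Probability.LatticeModels.Site 3); let vert : Sym2 (Literature.Probability.LatticeModels.Site 3) → Prop := fun e => ∃ x : Literature.Probability.LatticeModels.Site 3, e = s(x, x + Pi.single (2 : Fin 3) 1); let cfg : ℝ → ℝ → (Sym2 (Literature.Probability.LatticeModels.Site 3) → ℝ) → Set (Sym2 (Literature.Probability.LatticeModels.Site 3)) := fun p t U => {e | e ∈ (Literature.Probability.LatticeModels.zdGraph 3).edgeSet ∧ ((vert e ∧ U e ≤ t) ∨ (¬ vert e ∧ U e ≤ p))}; let Θ : ℕ → ℝ → ℝ → ℝ := fun n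 p t => μ.real {U | cfg p t U ∈ Literature.Probability.Percolation.siteToBoundary 3 n}; let θ : ℝ → ℝ → ℝ := fun p t => μ.real {U | cfg p t U ∈ Literature.Probability.Percolation.percolatesAt (0 : Literature.Probability.LatticeModels.Site 3)}; let pc : ℝ → ℝ := fun t => sInf ({p : ℝ | 0 ≤ p ∧ p ≤ 1 ∧ 0 < θ p t} ∪ {1}); ∀ lo hi : ℝ, 0 < lo → lo < hi → hi < 1 → ∃ ε > (0 : ℝ), ∀ n : ℕ, 1 ≤ n → ∀ t ∈ Set.Icc lo hi, ∀ p : ℝ, pc t ≤ p → p ≤ pc t + ε → 0 < deriv (fun q => Θ n q t) p) ↔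
    ∀ lo hi : ℝ, 0 < lo → lo < hi → hi < 1 → ∃ ε > (0 : ℝ), ∀ n : ℕ, 1 ≤ n →
      ∀ t ∈ Set.Icc lo hi, ∀ p : ℝ, pcA t ≤ p → p ≤ pcA t + ε → 0 < dP n p t :=
  Iff.rfl

/-! ## The seam (percolation-free real algebra) -/

/-- **Seam lemma.** For arbitrary families `N D : ℕ → ℝ → ℝ → ℝ` (here `∂_tΘ_n`, `∂_pΘ_n`) and an
arbitrary curve `pc`: a field `a`, `L`-Lipschitz in `p` on the `ρ`-collar, that controls `N − a D`
off every `ε`-window, together with asymptotic `η`-flatness of `N/D` across small windows and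
positivity of `D` on a window for `n ≥ 1`, controls `N − a D` on the whole closed collar: for `p` in
the window compare with `p' = pc t + ε'`, `ε' = min (min ε ε₀) (min ρ (η/(3(|L|+1))))`, through
`N/D(p) ≈ N/D(p') ≈ a(p') ≈ a(p)`. [folklore] -/
theorem seam {N D : ℕ → ℝ → ℝ → ℝ} {pc : ℝ → ℝ} {a : ℝ → ℝ → ℝ} {lo hi ρ L ε₀ : ℝ} (hρ : 0 < ρ)
    (hε₀ : 0 < ε₀)
    (hlip : ∀ t ∈ Set.Icc lo hi, ∀ p q : ℝ, pc t ≤ p → p ≤ pc t + ρ → pc t ≤ q → q ≤ pc t + ρ →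
      |a p t - a q t| ≤ L * |p - q|)
    (hoff : ∀ ε > (0 : ℝ), ∀ η > (0 : ℝ), ∃ m : ℕ, ∀ n ≥ m, ∀ t ∈ Set.Icc lo hi, ∀ p : ℝ,
      pc t + ε ≤ p → p ≤ pc t + ρ → |N n p t - a p t * D n p t| ≤ η * D n p t)
    (hwin : ∀ η > (0 : ℝ), ∃ ε > (0 : ℝ), ∃ m : ℕ, ∀ n ≥ m, ∀ t ∈ Set.Icc lo hi, ∀ p p' : ℝ,
      pc t ≤ p → p ≤ pc t + ε → pc t ≤ p' → p' ≤ pc t + ε →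
        |N n p t / D n p t - N n p' t / D n p' t| ≤ η)
    (hpos : ∀ n : ℕ, 1 ≤ n → ∀ t ∈ Set.Icc lo hi, ∀ p : ℝ, pc t ≤ p → p ≤ pc t + ε₀ → 0 < D n p t) :
    ∀ η > (0 : ℝ), ∃ m : ℕ, ∀ n ≥ m, ∀ t ∈ Set.Icc lo hi, ∀ p : ℝ, pc t ≤ p → p ≤ pc t + ρ →
      |N n p t - a p t * D n p t| ≤ η * D n p t := by
  intro η hη
  have hη3 : 0 < η / 3 := by positivity
  obtain ⟨ε, hε, m₁, hflat⟩ := hwin (η / 3) hη3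
  have hL1 : 0 < |L| + 1 := by positivity
  set ε' : ℝ := min (min ε ε₀) (min ρ (η / (3 * (|L| + 1)))) with hε'def
  have hε'pos : 0 < ε' := lt_min (lt_min hε hε₀) (lt_min hρ (by positivity))
  have hε'ε : ε' ≤ ε := (min_le_left _ _).trans (min_le_left _ _)
  have hε'ε₀ : ε' ≤ ε₀ := (min_le_left _ _).trans (min_le_right _ _)
  have hε'ρ : ε' ≤ ρ := (min_le_right _ _).trans (min_le_left _ _)
  have hε'L : ε' ≤ η / (3 * (|L| + 1)) := (min_le_right _ _).trans (min_le_right _ _)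
  obtain ⟨m₂, hoff₂⟩ := hoff ε' hε'pos η hη
  obtain ⟨m₃, hoff₃⟩ := hoff ε' hε'pos (η / 3) hη3
  refine ⟨max 1 (max m₁ (max m₂ m₃)), fun n hn t ht p hp1 hp2 => ?_⟩
  have hn₀ : 1 ≤ n := le_trans (le_max_left _ _) hn
  have hn₁ : m₁ ≤ n := le_trans ((le_max_left _ _).trans (le_max_right _ _)) hn
  have hn₂ : m₂ ≤ n :=
    le_trans (((le_max_left _ _).trans (le_max_right _ _)).trans (le_max_right _ _)) hn
  have hn₃ : m₃ ≤ n :=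
    le_trans (((le_max_right _ _).trans (le_max_right _ _)).trans (le_max_right _ _)) hn
  rcases le_or_gt (pc t + ε') p with hcase | hcase
  · exact hoff₂ n hn₂ t ht p hcase hp2
  · set p' : ℝ := pc t + ε' with hp'def
    have hq1 : pc t ≤ p' := by rw [hp'def]; linarith
    have hq2 : p' ≤ pc t + ε := by rw [hp'def]; linarith
    have hq3 : p' ≤ pc t + ρ := by rw [hp'def]; linarith
    have hq4 : p' ≤ pc t + ε₀ := by rw [hp'def]; linarith
    have hpε : p ≤ pc t + ε := by linarith
    have hpε₀ : p ≤ pc t + ε₀ := by linarith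
    have hdiff := hflat n hn₁ t ht p p' hp1 hpε hq1 hq2
    have hDp : 0 < D n p t := hpos n hn₀ t ht p hp1 hpε₀
    have hDq : 0 < D n p' t := hpos n hn₀ t ht p' hq1 hq4
    have h1 := hoff₃ n hn₃ t ht p' (le_of_eq hp'def.symm) hq3
    have hr1 : |N n p' t / D n p' t - a p' t| ≤ η / 3 := by
      have e : N n p' t / D n p' t - a p' t = (N n p' t - a p' t * D n p' t) / D n p' t := by
        field_simp
      rw [e, abs_div, abs_of_pos hDq, div_le_iff₀ hDq]
      exact h1
    have hl := hlip t ht p' p hq1 hq3 hp1 (by linarith)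
    have hpp' : |p' - p| ≤ ε' := by
      rw [abs_of_nonneg (by linarith)]
      linarith
    have hl' : |a p' t - a p t| ≤ η / 3 :=
      calc |a p' t - a p t| ≤ L * |p' - p| := hl
        _ ≤ |L| * |p' - p| := mul_le_mul_of_nonneg_right (le_abs_self L) (abs_nonneg _)
        _ ≤ |L| * ε' := mul_le_mul_of_nonneg_left hpp' (abs_nonneg L)
        _ ≤ |L| * (η / (3 * (|L| + 1))) := mul_le_mul_of_nonneg_left hε'L (abs_nonneg L)
        _ ≤ η / 3 := by
          rw [← sub_nonneg]
          have e : η / 3 - |L| * (η / (3 * (|L| + 1))) = (η / 3) * (1 / (|L| + 1)) := by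
            field_simp
            ring
          rw [e]
          positivity
    have hsum : |N n p t / D n p t - a p t| ≤ η := by
      calc |N n p t / D n p t - a p t|
          ≤ |N n p t / D n p t - N n p' t / D n p' t| + |N n p' t / D n p' t - a p' t| +
              |a p' t - a p t| := by
            have := abs_sub_le (N n p t / D n p t) (N n p' t / D n p' t) (a p t)
            have := abs_sub_le (N n p' t / D n p' t) (a p' t) (a p t)
            linarith
        _ ≤ η / 3 + η / 3 + η / 3 := by gcongr
        _ = η := by ring
    have e : N n p t - a p t * D n p t = (N n p t / D n p t - a p t) * D n p t := by
      field_simp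
    rw [e, abs_mul, abs_of_pos hDp]
    exact mul_le_mul_of_nonneg_right hsum hDp.le

/-- **Pointwise limit identification.** If `|N_n − a D_n| ≤ η D_n` eventually for every `η > 0`
and `D_n > 0` for `n ≥ 1`, then `N_n / D_n → a`, hence `limUnder atTop (N/D) = a`. [folklore] -/
theorem limUnder_ratio_eq {N D : ℕ → ℝ} {a : ℝ}
    (hconv : ∀ η > (0 : ℝ), ∃ m : ℕ, ∀ n ≥ m, |N n - a * D n| ≤ η * D n)
    (hpos : ∀ n : ℕ, 1 ≤ n → 0 < D n) :
    Tendsto (fun n => N n / D n) atTop (𝓝 a) ∧ limUnder atTop (fun n => N n / D n) = a := by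
  have ht : Tendsto (fun n => N n / D n) atTop (𝓝 a) := by
    rw [Metric.tendsto_atTop]
    intro η hη
    obtain ⟨m, hm⟩ := hconv (η / 2) (by positivity)
    refine ⟨max 1 m, fun n hn => ?_⟩
    have hn₀ : 1 ≤ n := le_trans (le_max_left _ _) hn
    have hn₁ : m ≤ n := le_trans (le_max_right _ _) hn
    have hD : 0 < D n := hpos n hn₀
    have h := hm n hn₁
    rw [Real.dist_eq]
    have e : N n / D n - a = (N n - a * D n) / D n := by field_simp
    rw [e, abs_div, abs_of_pos hD, div_lt_iff₀ hD]
    calc |N n - a * D n| ≤ η / 2 * D n := h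
      _ < η * D n := by nlinarith
  exact ⟨ht, ht.limUnder_eq⟩

/-! ## The composition: the four pieces imply the crux BY NAME -/

/-- **K⁺ from the four pieces** (hypotheses = the registered stubs `OffWindowLimit`,
`LimitFieldRegular`, `WindowFlatness`, `RussoPositivity` of stmt-CriticalPhenomena-16061, verbatim;
conclusion = the route decl `PercExchangeRateTransport.SupercritExchangeUniformity` by name).  On
`[lo,hi]` take `ρ₁` from piece 1, `ρ₂, L, a` from piece 2, `ε₀` from piece 4, set `ρ = min ρ₁ ρ₂`;
`a` is continuous and `p`-Lipschitz on the `ρ`-collar (restriction) and equals `a_∞` strictly above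
the curve, so piece 1 gives `|∂_tΘ_n − a ∂_pΘ_n| ≤ η ∂_pΘ_n` off every `ε`-window; the seam fed with
pieces 3 and 4 extends this to the whole closed collar. -/
theorem SupercritExchangeUniformity_of_subs :
    (let μ := Literature.Probability.Percolation.labelMeasure (Literature.Probability.LatticeModels.Site 3); let vert : Sym2 (Literature.Probability.LatticeModels.Site 3) → Prop := fun e => ∃ x : Literature.Probability.LatticeModels.Site 3, e = s(x, x + Pi.single (2 : Fin 3) 1); let cfg : ℝ → ℝ → (Sym2 (Literature.Probability.LatticeModels.Site 3) → ℝ) → Set (Sym2 (Literature.Probability.LatticeModels.Site 3)) := fun p t U => {e | e ∈ (Literature.Probability.LatticeModels.zdGraph 3).edgeSet ∧ ((vert e ∧ U e ≤ t) ∨ (¬ vert e ∧ U e ≤ p))}; let Θ : ℕ → ℝ → ℝ → ℝ := fun n p t => μ.real {U | cfg p t U ∈ Literature.Probability.Percolation.siteToBoundary 3 n}; let θ : ℝ → ℝ → ℝ := fun p t => μ.real {U | cfg p t U ∈ Literature.Probability.Percolation.percolatesAt (0 : Literature.Probability.LatticeModels.Site 3)}; let pc : ℝ → ℝ := fun t =>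 sInf ({p : ℝ | 0 ≤ p ∧ p ≤ 1 ∧ 0 < θ p t} ∪ {1}); let aInf : ℝ → ℝ → ℝ := fun p t => limUnder Filter.atTop (fun n : ℕ => deriv (fun s => Θ n p s) t / deriv (fun q => Θ n q t) p); ∀ lo hi : ℝ, 0 < lo → lo < hi → hi < 1 → ∃ ρ > (0 : ℝ), ∀ ε > (0 : ℝ), ∀ η > (0 : ℝ), ∃ m : ℕ, ∀ n ≥ m, ∀ t ∈ Set.Icc lo hi, ∀ p : ℝ, pc t + ε ≤ p → p ≤ pc t + ρ → |deriv (fun s => Θ n p s) t - aInf p t * deriv (fun q => Θ n q t) p| ≤ η * deriv (fun q => Θ n q t) p) →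
    (let μ := Literature.Probability.Percolation.labelMeasure (Literature.Probability.LatticeModels.Site 3); let vert : Sym2 (Literature.Probability.LatticeModels.Site 3) → Prop := fun e => ∃ x : Literature.Probability.LatticeModels.Site 3, e = s(x, x + Pi.single (2 : Fin 3) 1); let cfg : ℝ → ℝ → (Sym2 (Literature.Probability.LatticeModels.Site 3) → ℝ) → Set (Sym2 (Literature.Probability.LatticeModels.Site 3)) := fun p t U => {e | e ∈ (Literature.Probability.LatticeModels.zdGraph 3).edgeSet ∧ ((vert e ∧ U e ≤ t) ∨ (¬ vert e ∧ U e ≤ p))}; let Θ : ℕ → ℝ → ℝ → ℝ := fun n p t => μ.real {U | cfg p t U ∈ Literature.Probability.Percolation.siteToBoundary 3 n}; let θ : ℝ → ℝ → ℝ := fun p t => μ.real {U | cfg p t U ∈ Literature.Probability.Percolation.percolatesAt (0 : Literature.Probability.LatticeModels.Site 3)}; let pc : ℝ → ℝ := fun t => sInf ({p : ℝ | 0 ≤ p ∧ p ≤ 1 ∧ 0 < θ p t} ∪ {1}); let aInf : ℝ → ℝ → ℝ := fun p t => limUnder Filter.atTop (fun n : ℕ => deriv (fun s => Θ n p s) t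 / deriv (fun q => Θ n q t) p); ∀ lo hi : ℝ, 0 < lo → lo < hi → hi < 1 → ∃ ρ > (0 : ℝ), ∃ L : ℝ, ∃ a : ℝ → ℝ → ℝ, ContinuousOn (fun x : ℝ × ℝ => a x.1 x.2) {x : ℝ × ℝ | x.2 ∈ Set.Icc lo hi ∧ pc x.2 ≤ x.1 ∧ x.1 ≤ pc x.2 + ρ} ∧ (∀ t ∈ Set.Icc lo hi, ∀ p q : ℝ, pc t ≤ p → p ≤ pc t + ρ → pc t ≤ q → q ≤ pc t + ρ → |a p t - a q t| ≤ L * |p - q|) ∧ ∀ t ∈ Set.Icc lo hi, ∀ p : ℝ, pc t < p → p ≤ pc t + ρ → a p t = aInf p t) →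
    (let μ := Literature.Probability.Percolation.labelMeasure (Literature.Probability.LatticeModels.Site 3); let vert : Sym2 (Literature.Probability.LatticeModels.Site 3) → Prop := fun e => ∃ x : Literature.Probability.LatticeModels.Site 3, e = s(x, x + Pi.single (2 : Fin 3) 1); let cfg : ℝ → ℝ → (Sym2 (Literature.Probability.LatticeModels.Site 3) → ℝ) → Set (Sym2 (Literature.Probability.LatticeModels.Site 3)) := fun p t U => {e | e ∈ (Literature.Probability.LatticeModels.zdGraph 3).edgeSet ∧ ((vert e ∧ U e ≤ t) ∨ (¬ vert e ∧ U e ≤ p))}; let Θ : ℕ → ℝ → ℝ → ℝ := fun n p t => μ.real {U | cfg p t U ∈ Literature.Probability.Percolation.siteToBoundary 3 n}; let θ : ℝ → ℝ → ℝ := fun p t => μ.real {U | cfg p t U ∈ Literature.Probability.Percolation.percolatesAt (0 : Literature.Probability.LatticeModels.Site 3)}; let pc : ℝ → ℝ := fun t => sInf ({p : ℝ | 0 ≤ p ∧ p ≤ 1 ∧ 0 < θ p t} ∪ {1}); ∀ lo hi : ℝ, 0 < lo → lo < hi → hi < 1 → ∀ η > (0 : ℝ), ∃ ε > (0 : ℝ),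 ∃ m : ℕ, ∀ n ≥ m, ∀ t ∈ Set.Icc lo hi, ∀ p p' : ℝ, pc t ≤ p → p ≤ pc t + ε → pc t ≤ p' → p' ≤ pc t + ε → |deriv (fun s => Θ n p s) t / deriv (fun q => Θ n q t) p - deriv (fun s => Θ n p' s) t / deriv (fun q => Θ n q t) p'| ≤ η) →
    (let μ := Literature.Probability.Percolation.labelMeasure (Literature.Probability.LatticeModels.Site 3); let vert : Sym2 (Literature.Probability.LatticeModels.Site 3) → Prop := fun e => ∃ x : Literature.Probability.LatticeModels.Site 3, e = s(x, x + Pi.single (2 : Fin 3) 1); let cfg : ℝ → ℝ → (Sym2 (Literature.Probability.LatticeModels.Site 3) → ℝ) → Set (Sym2 (Literature.Probability.LatticeModels.Site 3)) := fun p t U => {e | e ∈ (Literature.Probability.LatticeModels.zdGraph 3).edgeSet ∧ ((vert e ∧ U e ≤ t) ∨ (¬ vert e ∧ U e ≤ p))}; let Θ : ℕ → ℝ → ℝ → ℝ := fun n p t => μ.real {U | cfg p t U ∈ Literature.Probability.Percolation.siteToBoundary 3 n}; let θ : ℝ → ℝ → ℝ := fun p t => μ.real {U | cfg p t U ∈ Literature.Probability.Percolation.percolatesAt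 (0 : Literature.Probability.LatticeModels.Site 3)}; let pc : ℝ → ℝ := fun t => sInf ({p : ℝ | 0 ≤ p ∧ p ≤ 1 ∧ 0 < θ p t} ∪ {1}); ∀ lo hi : ℝ, 0 < lo → lo < hi → hi < 1 → ∃ ε > (0 : ℝ), ∀ n : ℕ, 1 ≤ n → ∀ t ∈ Set.Icc lo hi, ∀ p : ℝ, pc t ≤ p → p ≤ pc t + ε → 0 < deriv (fun q => Θ n q t) p) →
    Summit.CriticalPhenomena.PercolationContinuityZ3.Theses.PercExchangeRateTransport.SupercritExchangeUniformity := by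
  intro hO hR hW hP
  refine crux_iff.2 fun lo hi hlo hlh hhi => ?_
  obtain ⟨ρ₁, hρ₁, hconv⟩ := offWindowLimit_iff.1 hO lo hi hlo hlh hhi
  obtain ⟨ρ₂, hρ₂, L, a, hcont, hlip, hagree⟩ := limitFieldRegular_iff.1 hR lo hi hlo hlh hhi
  have hwin := windowFlatness_iff.1 hW lo hi hlo hlh hhi
  obtain ⟨ε₀, hε₀, hpos⟩ := russoPositivity_iff.1 hP lo hi hlo hlh hhi
  set ρ : ℝ := min ρ₁ ρ₂ with hρdef
  have hρ : 0 < ρ := lt_min hρ₁ hρ₂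
  have hρle₁ : ρ ≤ ρ₁ := min_le_left _ _
  have hρle₂ : ρ ≤ ρ₂ := min_le_right _ _
  have hcont' : ContinuousOn (fun x : ℝ × ℝ => a x.1 x.2)
      {x : ℝ × ℝ | x.2 ∈ Set.Icc lo hi ∧ pcA x.2 ≤ x.1 ∧ x.1 ≤ pcA x.2 + ρ} :=
    hcont.mono fun x ⟨hx1, hx2, hx3⟩ => ⟨hx1, hx2, hx3.trans (by linarith)⟩
  have hlip' : ∀ t ∈ Set.Icc lo hi, ∀ p q : ℝ, pcA t ≤ p → p ≤ pcA t + ρ → pcA t ≤ q →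
      q ≤ pcA t + ρ → |a p t - a q t| ≤ L * |p - q| :=
    fun t ht p q hp1 hp2 hq1 hq2 => hlip t ht p q hp1 (by linarith) hq1 (by linarith)
  have hoff : ∀ ε > (0 : ℝ), ∀ η > (0 : ℝ), ∃ m : ℕ, ∀ n ≥ m, ∀ t ∈ Set.Icc lo hi, ∀ p : ℝ,
      pcA t + ε ≤ p → p ≤ pcA t + ρ → |dT n p t - a p t * dP n p t| ≤ η * dP n p t := by
    intro ε hε η hη
    obtain ⟨m, hm⟩ := hconv ε hε η hη
    refine ⟨m, fun n hn t ht p hp1 hp2 => ?_⟩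
    rw [hagree t ht p (by linarith) (by linarith)]
    exact hm n hn t ht p hp1 (by linarith)
  exact ⟨ρ, hρ, L, a, hcont', hlip', seam hρ hε₀ hlip' hoff hwin hpos⟩

/-! ## The converse: the split is lossless modulo `RussoPositivity` -/

/-- **The pieces from K⁺** (modulo positivity).  Given K⁺'s `ρ, L, a` on `[lo,hi]` and the
positivity window `ε₀`, on the collar of radius `ρ' = min ρ ε₀` the ratio `a_n → a` pointwise, so
`a = a_∞` there: this is piece 2 (with `ρ'`), turns K⁺ into piece 1 (with `ρ'`), and gives piece 3
with `ε = min ρ' (η/(3(|L|+1)))` through `a_n(p) ≈ a(p) ≈ a(p') ≈ a_n(p')`. -/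
theorem subs_of_SupercritExchangeUniformity
    (hK : Summit.CriticalPhenomena.PercolationContinuityZ3.Theses.PercExchangeRateTransport.SupercritExchangeUniformity) :
    (let μ := Literature.Probability.Percolation.labelMeasure (Literature.Probability.LatticeModels.Site 3); let vert : Sym2 (Literature.Probability.LatticeModels.Site 3) → Prop := fun e => ∃ x : Literature.Probability.LatticeModels.Site 3, e = s(x, x + Pi.single (2 : Fin 3) 1); let cfg : ℝ → ℝ → (Sym2 (Literature.Probability.LatticeModels.Site 3) → ℝ) → Set (Sym2 (Literature.Probability.LatticeModels.Site 3)) := fun p t U => {e | e ∈ (Literature.Probability.LatticeModels.zdGraph 3).edgeSet ∧ ((vert e ∧ U e ≤ t) ∨ (¬ vert e ∧ U e ≤ p))}; let Θ : ℕ → ℝ → ℝ → ℝ := fun n p t => μ.real {U | cfg p t U ∈ Literature.Probability.Percolation.siteToBoundary 3 n}; let θ : ℝ → ℝ → ℝ := fun p t => μ.real {U | cfg p t U ∈ Literature.Probability.Percolation.percolatesAt (0 : Literature.Probability.LatticeModels.Site 3)}; let pc : ℝ → ℝ := fun t => sInf ({p : ℝ | 0 ≤ p ∧ p ≤ 1 ∧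 0 < θ p t} ∪ {1}); ∀ lo hi : ℝ, 0 < lo → lo < hi → hi < 1 → ∃ ε > (0 : ℝ), ∀ n : ℕ, 1 ≤ n → ∀ t ∈ Set.Icc lo hi, ∀ p : ℝ, pc t ≤ p → p ≤ pc t + ε → 0 < deriv (fun q => Θ n q t) p) →
    (let μ := Literature.Probability.Percolation.labelMeasure (Literature.Probability.LatticeModels.Site 3); let vert : Sym2 (Literature.Probability.LatticeModels.Site 3) → Prop := fun e => ∃ x : Literature.Probability.LatticeModels.Site 3, e = s(x, x + Pi.single (2 : Fin 3) 1); let cfg : ℝ → ℝ → (Sym2 (Literature.Probability.LatticeModels.Site 3) → ℝ) → Set (Sym2 (Literature.Probability.LatticeModels.Site 3)) := fun p t U => {e | e ∈ (Literature.Probability.LatticeModels.zdGraph 3).edgeSet ∧ ((vert e ∧ U e ≤ t) ∨ (¬ vert e ∧ U e ≤ p))}; let Θ : ℕ → ℝ → ℝ → ℝ := fun n p t => μ.real {U | cfg p t U ∈ Literature.Probability.Percolation.siteToBoundary 3 n}; let θ : ℝ → ℝ → ℝ := fun p t => μ.real {U | cfg p t U ∈ Literature.Probability.Percolation.percolatesAt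 (0 : Literature.Probability.LatticeModels.Site 3)}; let pc : ℝ → ℝ := fun t => sInf ({p : ℝ | 0 ≤ p ∧ p ≤ 1 ∧ 0 < θ p t} ∪ {1}); let aInf : ℝ → ℝ → ℝ := fun p t => limUnder Filter.atTop (fun n : ℕ => deriv (fun s => Θ n p s) t / deriv (fun q => Θ n q t) p); ∀ lo hi : ℝ, 0 < lo → lo < hi → hi < 1 → ∃ ρ > (0 : ℝ), ∀ ε > (0 : ℝ), ∀ η > (0 : ℝ), ∃ m : ℕ, ∀ n ≥ m, ∀ t ∈ Set.Icc lo hi, ∀ p : ℝ, pc t + ε ≤ p → p ≤ pc t + ρ → |deriv (fun s => Θ n p s) t - aInf p t * deriv (fun q => Θ n q t) p| ≤ η * deriv (fun q => Θ n q t) p) ∧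
    (let μ := Literature.Probability.Percolation.labelMeasure (Literature.Probability.LatticeModels.Site 3); let vert : Sym2 (Literature.Probability.LatticeModels.Site 3) → Prop := fun e => ∃ x : Literature.Probability.LatticeModels.Site 3, e = s(x, x + Pi.single (2 : Fin 3) 1); let cfg : ℝ → ℝ → (Sym2 (Literature.Probability.LatticeModels.Site 3) → ℝ) → Set (Sym2 (Literature.Probability.LatticeModels.Site 3)) := fun p t U => {e | e ∈ (Literature.Probability.LatticeModels.zdGraph 3).edgeSet ∧ ((vert e ∧ U e ≤ t) ∨ (¬ vert e ∧ U e ≤ p))}; let Θ : ℕ → ℝ → ℝ → ℝ := fun n p t => μ.real {U | cfg p t U ∈ Literature.Probability.Percolation.siteToBoundary 3 n}; let θ : ℝ → ℝ → ℝ := fun p t => μ.real {U | cfg p t U ∈ Literature.Probability.Percolation.percolatesAt (0 : Literature.Probability.LatticeModels.Site 3)}; let pc : ℝ → ℝ := fun t => sInf ({p : ℝ | 0 ≤ p ∧ p ≤ 1 ∧ 0 < θ p t} ∪ {1}); let aInf : ℝ → ℝ → ℝ := fun p t => limUnder Filter.atTop (fun n : ℕ => deriv (fun s => Θ n p s) t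 / deriv (fun q => Θ n q t) p); ∀ lo hi : ℝ, 0 < lo → lo < hi → hi < 1 → ∃ ρ > (0 : ℝ), ∃ L : ℝ, ∃ a : ℝ → ℝ → ℝ, ContinuousOn (fun x : ℝ × ℝ => a x.1 x.2) {x : ℝ × ℝ | x.2 ∈ Set.Icc lo hi ∧ pc x.2 ≤ x.1 ∧ x.1 ≤ pc x.2 + ρ} ∧ (∀ t ∈ Set.Icc lo hi, ∀ p q : ℝ, pc t ≤ p → p ≤ pc t + ρ → pc t ≤ q → q ≤ pc t + ρ → |a p t - a q t| ≤ L * |p - q|) ∧ ∀ t ∈ Set.Icc lo hi, ∀ p : ℝ, pc t < p → p ≤ pc t + ρ → a p t = aInf p t) ∧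
    (let μ := Literature.Probability.Percolation.labelMeasure (Literature.Probability.LatticeModels.Site 3); let vert : Sym2 (Literature.Probability.LatticeModels.Site 3) → Prop := fun e => ∃ x : Literature.Probability.LatticeModels.Site 3, e = s(x, x + Pi.single (2 : Fin 3) 1); let cfg : ℝ → ℝ → (Sym2 (Literature.Probability.LatticeModels.Site 3) → ℝ) → Set (Sym2 (Literature.Probability.LatticeModels.Site 3)) := fun p t U => {e | e ∈ (Literature.Probability.LatticeModels.zdGraph 3).edgeSet ∧ ((vert e ∧ U e ≤ t) ∨ (¬ vert e ∧ U e ≤ p))}; let Θ : ℕ → ℝ → ℝ → ℝ := fun n p t => μ.real {U | cfg p t U ∈ Literature.Probability.Percolation.siteToBoundary 3 n}; let θ : ℝ → ℝ → ℝ := fun p t => μ.real {U | cfg p t U ∈ Literature.Probability.Percolation.percolatesAt (0 : Literature.Probability.LatticeModels.Site 3)}; let pc : ℝ → ℝ := fun t => sInf ({p : ℝ | 0 ≤ p ∧ p ≤ 1 ∧ 0 < θ p t} ∪ {1}); ∀ lo hi : ℝ, 0 < lo → lo < hi → hi < 1 → ∀ η > (0 : ℝ), ∃ ε > (0 : ℝ),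 ∃ m : ℕ, ∀ n ≥ m, ∀ t ∈ Set.Icc lo hi, ∀ p p' : ℝ, pc t ≤ p → p ≤ pc t + ε → pc t ≤ p' → p' ≤ pc t + ε → |deriv (fun s => Θ n p s) t / deriv (fun q => Θ n q t) p - deriv (fun s => Θ n p' s) t / deriv (fun q => Θ n q t) p'| ≤ η) := by
  intro hP
  have hK' := crux_iff.1 hK
  have hP' := russoPositivity_iff.1 hP
  -- the common core on one sub-arc: K⁺'s data, the positivity window, and `a = a_∞` on `min ρ ε₀`
  have core : ∀ lo hi : ℝ, 0 < lo → lo < hi → hi < 1 → ∃ ρ > (0 : ℝ), ∃ L : ℝ, ∃ a : ℝ → ℝ → ℝ,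
      ContinuousOn (fun x : ℝ × ℝ => a x.1 x.2)
          {x : ℝ × ℝ | x.2 ∈ Set.Icc lo hi ∧ pcA x.2 ≤ x.1 ∧ x.1 ≤ pcA x.2 + ρ} ∧
        (∀ t ∈ Set.Icc lo hi, ∀ p q : ℝ, pcA t ≤ p → p ≤ pcA t + ρ → pcA t ≤ q → q ≤ pcA t + ρ →
          |a p t - a q t| ≤ L * |p - q|) ∧
        (∀ η > (0 : ℝ), ∃ m : ℕ, ∀ n ≥ m, ∀ t ∈ Set.Icc lo hi, ∀ p : ℝ, pcA t ≤ p →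
          p ≤ pcA t + ρ → |dT n p t - a p t * dP n p t| ≤ η * dP n p t) ∧
        (∀ n : ℕ, 1 ≤ n → ∀ t ∈ Set.Icc lo hi, ∀ p : ℝ, pcA t ≤ p → p ≤ pcA t + ρ →
          0 < dP n p t) ∧
        (∀ t ∈ Set.Icc lo hi, ∀ p : ℝ, pcA t ≤ p → p ≤ pcA t + ρ → a p t = rateLim p t) := by
    intro lo hi hlo hlh hhi
    obtain ⟨ρ, hρ, L, a, hcont, hlip, hconv⟩ := hK' lo hi hlo hlh hhi
    obtain ⟨ε₀, hε₀, hpos⟩ := hP' lo hi hlo hlh hhi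
    set ρ' : ℝ := min ρ ε₀ with hρ'def
    have hρ' : 0 < ρ' := lt_min hρ hε₀
    have h₁ : ρ' ≤ ρ := min_le_left _ _
    have h₂ : ρ' ≤ ε₀ := min_le_right _ _
    refine ⟨ρ', hρ', L, a, ?_, ?_, ?_, ?_, ?_⟩
    · exact hcont.mono fun x ⟨hx1, hx2, hx3⟩ => ⟨hx1, hx2, hx3.trans (by linarith)⟩
    · exact fun t ht p q hp1 hp2 hq1 hq2 => hlip t ht p q hp1 (by linarith) hq1 (by linarith)
    · intro η hη
      obtain ⟨m, hm⟩ := hconv η hη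
      exact ⟨m, fun n hn t ht p hp1 hp2 => hm n hn t ht p hp1 (by linarith)⟩
    · exact fun n hn t ht p hp1 hp2 => hpos n hn t ht p hp1 (by linarith)
    · intro t ht p hp1 hp2
      have h := limUnder_ratio_eq (N := fun n => dT n p t) (D := fun n => dP n p t) (a := a p t)
        (fun η hη => by
          obtain ⟨m, hm⟩ := hconv η hη
          exact ⟨m, fun n hn => hm n hn t ht p hp1 (by linarith)⟩)
        (fun n hn => hpos n hn t ht p hp1 (by linarith))
      exact h.2.symm
  refine ⟨?_, ?_, ?_⟩
  · -- piece 1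
    refine offWindowLimit_iff.2 fun lo hi hlo hlh hhi => ?_
    obtain ⟨ρ, hρ, L, a, -, -, hconv, -, hagree⟩ := core lo hi hlo hlh hhi
    refine ⟨ρ, hρ, fun ε hε η hη => ?_⟩
    obtain ⟨m, hm⟩ := hconv η hη
    refine ⟨m, fun n hn t ht p hp1 hp2 => ?_⟩
    rw [← hagree t ht p (by linarith) hp2]
    exact hm n hn t ht p (by linarith) hp2
  · -- piece 2
    refine limitFieldRegular_iff.2 fun lo hi hlo hlh hhi => ?_
    obtain ⟨ρ, hρ, L, a, hcont, hlip, -, -, hagree⟩ := core lo hi hlo hlh hhi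
    exact ⟨ρ, hρ, L, a, hcont, hlip, fun t ht p hp1 hp2 => hagree t ht p hp1.le hp2⟩
  · -- piece 3
    refine windowFlatness_iff.2 fun lo hi hlo hlh hhi η hη => ?_
    obtain ⟨ρ, hρ, L, a, -, hlip, hconv, hpos, -⟩ := core lo hi hlo hlh hhi
    have hη3 : 0 < η / 3 := by positivity
    have hL1 : 0 < |L| + 1 := by positivity
    set ε : ℝ := min ρ (η / (3 * (|L| + 1))) with hεdef
    have hε : 0 < ε := lt_min hρ (by positivity)
    have hερ : ε ≤ ρ := min_le_left _ _
    have hεL : ε ≤ η / (3 * (|L| + 1)) := min_le_right _ _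
    obtain ⟨m, hm⟩ := hconv (η / 3) hη3
    refine ⟨ε, hε, max 1 m, fun n hn t ht p p' hp1 hp2 hq1 hq2 => ?_⟩
    have hn₀ : 1 ≤ n := le_trans (le_max_left _ _) hn
    have hn₁ : m ≤ n := le_trans (le_max_right _ _) hn
    have hDp : 0 < dP n p t := hpos n hn₀ t ht p hp1 (by linarith)
    have hDq : 0 < dP n p' t := hpos n hn₀ t ht p' hq1 (by linarith)
    have hrp : |dT n p t / dP n p t - a p t| ≤ η / 3 := by
      have e : dT n p t / dP n p t - a p t = (dT n p t - a p t * dP n p t) / dP n p t := by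
        field_simp
      rw [e, abs_div, abs_of_pos hDp, div_le_iff₀ hDp]
      exact hm n hn₁ t ht p hp1 (by linarith)
    have hrq : |dT n p' t / dP n p' t - a p' t| ≤ η / 3 := by
      have e : dT n p' t / dP n p' t - a p' t = (dT n p' t - a p' t * dP n p' t) / dP n p' t := by
        field_simp
      rw [e, abs_div, abs_of_pos hDq, div_le_iff₀ hDq]
      exact hm n hn₁ t ht p' hq1 (by linarith)
    have hl := hlip t ht p p' hp1 (by linarith) hq1 (by linarith)
    have hpp' : |p - p'| ≤ ε := by
      rw [abs_le]; constructor <;> linarith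
    have hl' : |a p t - a p' t| ≤ η / 3 :=
      calc |a p t - a p' t| ≤ L * |p - p'| := hl
        _ ≤ |L| * |p - p'| := mul_le_mul_of_nonneg_right (le_abs_self L) (abs_nonneg _)
        _ ≤ |L| * ε := mul_le_mul_of_nonneg_left hpp' (abs_nonneg L)
        _ ≤ |L| * (η / (3 * (|L| + 1))) := mul_le_mul_of_nonneg_left hεL (abs_nonneg L)
        _ ≤ η / 3 := by
          rw [← sub_nonneg]
          have e : η / 3 - |L| * (η / (3 * (|L| + 1))) = (η / 3) * (1 / (|L| + 1)) := by
            field_simp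
            ring
          rw [e]
          positivity
    calc |dT n p t / dP n p t - dT n p' t / dP n p' t|
        ≤ |dT n p t / dP n p t - a p t| + |a p t - a p' t| + |a p' t - dT n p' t / dP n p' t| := by
          have := abs_sub_le (dT n p t / dP n p t) (a p t) (dT n p' t / dP n p' t)
          have := abs_sub_le (a p t) (a p' t) (dT n p' t / dP n p' t)
          linarith
      _ ≤ η / 3 + η / 3 + η / 3 := by rw [abs_sub_comm (a p' t)]; gcongr
      _ = η := by ring

end Summit.CriticalPhenomena.PercolationContinuityZ3.SupercritExchangeUniformitySplit

end
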